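import Literature.AlgebraicGeometry.HodgeTheory.MotivatedClassesAlgebraic
import Literature.AlgebraicGeometry.HodgeTheory.MotivatedClassesTransport
import Literature.AlgebraicGeometry.HodgeTheory.TopDegreeClasses
import Literature.AlgebraicGeometry.Motives.VarietiesUnitProofs
import HarnessLib

/-!
# `*_L A(X) ⊆ A_mot(X)` and `A(X) ⊆ A_mot(X)` from a polarisation of `X` alone: André's generators with the point as auxiliary variety (André 1996, §2.1)

Family `hodge`, layer `Literature/AlgebraicGeometry/HodgeTheory`. Companion (theorems only) of
`MotivatedClasses.lean` (André's motivated classes `A_motᵖ(X)_ℂ = motivatedClasses n X p`, the span of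
the generators `pr_{X*}(α ∪ *_L β)`, Y. André, *Pour une théorie inconditionnelle des motifs*, Publ.
Math. IHÉS 83 (1996), §2.1 Déf. 1) and of `MotivatedClassesAlgebraic.lean` (`A(X) ⊆ A_mot(X)` with the
auxiliary variety `Y := X`, hence under a polarisation class of `X ⊗ X`).

Source, verbatim (§2.1, remark following Déf. 1, p. 14): "Il est clair que `A_mot(X)_E` contient
`A(X)` et `*A(X)` (prendre `α` ou `β` égal à la classe fondamentale de `X × Y`)". Here the auxiliary
variety is the POINT `Y := Spec ℂ = 𝟙_ (SchemeOver ℂ)` (the empty product, an object of `𝒱` by the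
footnote (1) to §2.1, p. 13: "On convient que le produit vide est `Spec K`"; smooth projective of
dimension `0`, the tree's `Motives.isSmoothProjective_unit_holds`), for which `X × Y ≅ X` by the
unitor `ρ_X` (`= pr_X`), so that a polarisation class `η` of `X` ITSELF polarises `X × Y` and
`pr_{X*} ∘ ρ_X^* = id`:

* `isMotivatedClass_of_eq_cupProduct_lefschetzInvolution` — **the point generators**: for `η` a
  polarisation class of `X` and algebraic `α ∈ Nᵃ H²ᵃ(X(ℂ))`, `β ∈ Nᵇ H²ᵇ(X(ℂ))` (`b + b' = n`,
  `a + b' = p ≤ n`), the class `α ∪ *_{L_η} β ∈ H²ᵖ(X(ℂ); ℂ)` is one of André's generators of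
  `A_motᵖ(X)_ℂ` (`IsMotivatedClass`), namely `pr_{X*}(ρ^* α ∪ *_{L_{ρ^*η}} ρ^* β)` on `X ⊗ 𝟙`, with the
  orientation of `(X ⊗ 𝟙)(ℂ)` transported from that of `X(ℂ)` along the homeomorphism `ρ(ℂ)`
  (`gysinMap_comap_map_of_homeomorph`: for a homeomorphism `h` and the transported orientation,
  `h_! ∘ h^* = id`, Fulton App. B (5)–(7) with `deg h = 1`; `*_L`, `∪`, polarisations and algebraic
  classes commute with `ρ^*`: the tree's `lefschetzInvolution_map`, `cupProduct_map`,
  `IsPolarizationClass.map_of_iso`, `mem_algebraicClasses_map_of_iso` of `MotivatedClassesTransport`).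
* `isMotivatedClass_lefschetzInvolution`, `lefschetzInvolution_mem_motivatedClasses`,
  `map_algebraicClasses_lefschetzInvolution_le` — **`*_L A(X) ⊆ A_mot(X)`** ("prendre `α` égal à la
  classe fondamentale": `α = 1 = [X × Y]`): `*_{L_η} c ∈ A_mot^{b'}(X)_ℂ` for `c ∈ Nᵇ H²ᵇ(X(ℂ))`,
  `b + b' = n`.
* `isMotivatedClass_of_mem_algebraicClasses_of_isPolarizationClass`,
  `algebraicClasses_le_motivatedClasses_of_isPolarizationClass`,
  `algebraicClasses_le_motivatedClasses_of_nonempty_hardLefschetzNFold_self` — **`A(X) ⊆ A_mot(X)`**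
  given only a polarisation class of `X` (resp. the hard Lefschetz datum `nonempty_hardLefschetzNFold n X`
  of `X` itself, instead of that of `X ⊗ X` used in `MotivatedClassesAlgebraic`): take `β ∈ H²ⁿ(X(ℂ))`
  with `*_L β = 1` (`β = *_L 1 = ηⁿ`; every top-degree class is algebraic,
  `mem_algebraicClasses_of_degree_top`) and `α = c`, so that `c = c ∪ 1 = α ∪ *_L β`.
* `Andre1996_deformation.map_fiber_mem_motivatedClasses_of_mem_algebraicClasses_self` — the §6.3
  glue "an algebraic fibre motivates all fibres" (Thm. 0.5, granted as the named fact
  `Andre1996_deformation`) under the hard Lefschetz datum of the fibre `𝒳_{s₀}` alone.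

## References

* [Andre1996Motifs] Y. André, Pour une théorie inconditionnelle des motifs, Publ. Math. IHÉS 83
  (1996) 5–49: §2.1 Déf. 1 and the remark following it (p. 14), footnote (1) p. 13, §1.1 (p. 10).
* [FultonYoungTableaux1997] W. Fulton, Young Tableaux, CUP 1997, App. B §B.1 (5)–(7).
* [HatcherAT2002] A. Hatcher, Algebraic Topology, CUP 2002, §3.3 Thm. 3.26, Thm. 3.30.
-/

noncomputable section

open CategoryTheory AlgebraicGeometry MonoidalCategory CartesianMonoidalCategory
open Literature.AlgebraicTopology.SingularHomology Literature.Geometry.Kaehler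

universe u v

/-! ### Topology: the Gysin map of a homeomorphism inverts its pull-back -/

namespace Literature.AlgebraicTopology.SingularHomology

section Homeomorph

variable {R : Type v} [CommRing R]
variable {X Y : Type u} [TopologicalSpace X] [TopologicalSpace Y] {n : ℕ}

/-- A homeomorphism `h : Y ≃ₜ X` onto a closed `R`-oriented manifold has degree `1` for the
transported orientation: `h_* [Y]_{μ.comap h} = [X]_μ` (`[Y]_{μ.comap h} = (h⁻¹)_* [X]_μ`, the tree's
`HomologicalOrientation.fundamentalClass_comap_of_compactSpace`, Hatcher Thm. 3.26).
[cite: HatcherAT2002, §3.3 Thm. 3.26 (a) and Lemma 3.27] -/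
theorem hasDegree_one_comap_homeomorph [CompactSpace X] [T2Space X]
    [ChartedSpace (EuclideanSpace ℝ (Fin n)) X] (μ : HomologicalOrientation R X n) (h : Y ≃ₜ X) :
    HasDegree (μ.comap h) μ (h : C(Y, X)) 1 := by
  rw [HasDegree, HomologicalOrientation.fundamentalClass_comap_of_compactSpace μ h,
    singularHomology.map_map_symm, one_zsmul]

/-- **`h_! (h^* x) = x`** for a homeomorphism `h : Y ≃ₜ X` onto a closed `R`-oriented manifold `X`
whose orientation `μ` satisfies Poincaré duality, `Y` carrying the transported orientation
`μ.comap h` (`h_!` the Gysin map `D_X⁻¹ ∘ h_* ∘ D_Y`, Fulton App. B (5); projection formula (6) with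
`deg h = 1`, (7): the tree's `gysinMap_map_of_hasDegree`). [cite: FultonYoungTableaux1997, Appendix B §B.1 (5)–(7)] -/
theorem gysinMap_comap_map_of_homeomorph [CompactSpace X] [T2Space X]
    [ChartedSpace (EuclideanSpace ℝ (Fin n)) X] {μ : HomologicalOrientation R X n}
    (hμ : μ.HasPoincareDuality) (h : Y ≃ₜ X) {p q : ℕ} (hpq : p + q = n)
    (x : singularCohomology R R X p) :
    gysinMap (μ.comap h) μ (h : C(Y, X)) hpq hpq (singularCohomology.map R R (h : C(Y, X)) p x) = x := by
  rw [gysinMap_map_of_hasDegree hμ (hasDegree_one_comap_homeomorph μ h) hpq x, one_zsmul]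

end Homeomorph

end Literature.AlgebraicTopology.SingularHomology

/-! ### André's generators with the point as auxiliary variety -/

namespace Literature.AlgebraicGeometry.HodgeTheory

section HodgeTheory

variable {n : ℕ} {X : Motives.SchemeOver ℂ}

/-- **The point generators.** Let `X` be smooth projective of dimension `n` over `ℂ`, `η` a
polarisation class of `X`, `α ∈ Nᵃ H²ᵃ(X(ℂ); ℂ)`, `β ∈ Nᵇ H²ᵇ(X(ℂ); ℂ)` algebraic, `b + b' = n`,
`a + b' = p ≤ n`. Then `x = α ∪ *_{L_η} β ∈ H²ᵖ(X(ℂ); ℂ)` is one of André's generators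
`pr_{X*}(α' ∪ *_L β')` of `A_motᵖ(X)_ℂ` (Déf. 1), with the auxiliary variety `Y := Spec ℂ = 𝟙` (the
empty product, footnote (1) p. 13), `X ⊗ 𝟙 ≅ X` by the unitor `ρ = pr_X`, the polarisation `ρ^* η` of
`X ⊗ 𝟙`, the algebraic classes `α' = ρ^* α`, `β' = ρ^* β`, any `ℂ`-orientation `ν` of `X(ℂ)` (with
Poincaré duality, Hatcher Thm. 3.30) and the transported orientation `ν.comap ρ(ℂ)` of `(X ⊗ 𝟙)(ℂ)`:
`ρ^* α ∪ *_{L_{ρ^*η}} ρ^* β = ρ^*(α ∪ *_{L_η} β)` and `pr_{X!} ρ^* = ρ_! ρ^* = id`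
(`gysinMap_comap_map_of_homeomorph`). [cite: Andre1996Motifs, §2.1 Déf. 1 and remark (p. 14), footnote (1) p. 13]
[cite: FultonYoungTableaux1997, Appendix B §B.1 (5)–(7)] -/
theorem isMotivatedClass_of_eq_cupProduct_lefschetzInvolution (hX : Motives.IsSmoothProjective n X)
    {η : complexBetti X 2} (hη : IsPolarizationClass n X η) {p a b b' : ℕ} (hbb' : b + b' = n)
    (hab : a + b' = p) (hp : p ≤ n) (h₃ : 2 * a + 2 * b' = 2 * p) (h₄ : 2 * b + 2 * b' = 2 * n)
    {α : complexBetti X (2 * a)} {β : complexBetti X (2 * b)} (hα : α ∈ algebraicClasses X a)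
    (hβ : β ∈ algebraicClasses X b) {x : complexBetti X (2 * p)}
    (hx : x = cupProduct h₃ α (lefschetzInvolution hη.hasHardLefschetz h₄ β)) :
    IsMotivatedClass n X p x := by
  classical
  -- the point `Spec ℂ = 𝟙` and the unitor `ρ_X = pr_X : X ⊗ 𝟙 ≅ X`
  obtain ⟨P, hP, e, he⟩ : ∃ (P : Motives.SchemeOver ℂ) (_ : Motives.IsSmoothProjective 0 P)
      (e : X ⊗ P ≅ X), e.hom = fst X P :=
    ⟨𝟙_ (Motives.SchemeOver ℂ), Motives.isSmoothProjective_unit_holds ℂ, ρ_ X, rightUnitor_hom X⟩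
  have hXP : Motives.IsSmoothProjective (n + 0) (X ⊗ P) := Motives.IsSmoothProjective.tensor_holds hX hP
  -- a `ℂ`-orientation of `X(ℂ)` with Poincaré duality, transported to `(X ⊗ 𝟙)(ℂ)` along `ρ(ℂ)`
  obtain ⟨μ, hμ⟩ : ∃ μ : OrientationFamily, μ.HasPoincareDuality :=
    ⟨fun _ _ h ↦ Classical.choice (Motives.ComplexPoints.isOrientableOver ℂ h),
      OrientationFamily.hasPoincareDuality _⟩
  letI := hX.chartedSpace
  haveI := Motives.ComplexPoints.compactSpace_of_isSmoothProjective hX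
  haveI := Motives.ComplexPoints.t2Space_of_isSmoothProjective hX
  have hν : (μ hX).HasPoincareDuality := hμ hX
  have hνρ : ((μ hX).comap (Motives.AlgPoints.homeomorphOfIso (L := ℂ) e)).HasPoincareDuality :=
    hν.comap _
  -- the transported polarisation and algebraic classes
  have hη' : IsPolarizationClass n (X ⊗ P) (complexBetti.map e.hom 2 η) := hη.map_of_iso hX hXP e
  have hα' : complexBetti.map e.hom (2 * a) α ∈ algebraicClasses (X ⊗ P) a :=
    mem_algebraicClasses_map_of_iso hX hXP e hα
  have hβ' : complexBetti.map e.hom (2 * b) β ∈ algebraicClasses (X ⊗ P) b :=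
    mem_algebraicClasses_map_of_iso hX hXP e hβ
  have h₂ : 2 * p + 2 * (n - p) = 2 * n := by omega
  -- `ρ^* α ∪ *_{L'} ρ^* β = ρ^* (α ∪ *_L β)`
  have hmap : ∀ i, complexBetti.map e.hom i =
      singularCohomology.map ℂ ℂ (Motives.AlgPoints.homeomorphOfIso (L := ℂ) e :
        C(Motives.ComplexPoints (X ⊗ P), Motives.ComplexPoints X)) i := fun i ↦ rfl
  have key : cupProduct h₃ (complexBetti.map e.hom (2 * a) α)
      (lefschetzInvolution hη'.hasHardLefschetz h₄ (complexBetti.map e.hom (2 * b) β)) =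
      singularCohomology.map ℂ ℂ (Motives.AlgPoints.homeomorphOfIso (L := ℂ) e :
        C(Motives.ComplexPoints (X ⊗ P), Motives.ComplexPoints X)) (2 * p) x := by
    rw [hx, cupProduct_map, ← hmap, ← hmap, lefschetzInvolution_map e.hom hη.hasHardLefschetz
      hη'.hasHardLefschetz]
  -- `pr_{X!} (ρ^* x) = x` for the transported orientation
  have final : gysinMap ((μ hX).comap (Motives.AlgPoints.homeomorphOfIso (L := ℂ) e)) (μ hX)
      (Motives.AlgPoints.homeomorphOfIso (L := ℂ) e :
        C(Motives.ComplexPoints (X ⊗ P), Motives.ComplexPoints X)) h₂ h₂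
      (cupProduct h₃ (complexBetti.map e.hom (2 * a) α)
        (lefschetzInvolution hη'.hasHardLefschetz h₄ (complexBetti.map e.hom (2 * b) β))) = x := by
    rw [key]
    exact gysinMap_comap_map_of_homeomorph hν _ h₂ x
  have hfst : Motives.AlgPoints.mapContinuous (L := ℂ) (fst X P) =
      (Motives.AlgPoints.homeomorphOfIso (L := ℂ) e :
        C(Motives.ComplexPoints (X ⊗ P), Motives.ComplexPoints X)) := by
    rw [← he]
    rfl
  refine ⟨0, P, hP, (μ hX).comap (Motives.AlgPoints.homeomorphOfIso (L := ℂ) e), μ hX, hνρ, hν,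
    complexBetti.map e.hom 2 η, hη', a, b, b', n - p, by omega, by omega, by omega,
    complexBetti.map e.hom (2 * a) α, complexBetti.map e.hom (2 * b) β, hα', hβ', ?_⟩
  rw [hfst]
  exact final.symm

/-! ### `*_L A(X) ⊆ A_mot(X)` -/

/-- **`*_L` of an algebraic class is a generator of `A_mot(X)`** (André 1996, §2.1, remark after
Déf. 1, p. 14: "Il est clair que `A_mot(X)_E` contient […] `*A(X)` (prendre `α` […] égal à la classe
fondamentale de `X × Y`)", with `Y = Spec ℂ`, `α = 1`): for `X` smooth projective of dimension `n`, a
polarisation class `η` of `X`, `b + b' = n` and `c ∈ Nᵇ H²ᵇ(X(ℂ); ℂ) = algebraicClasses X b`, the class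
`*_{L_η} c ∈ H^{2b'}(X(ℂ); ℂ)` is one of André's generators (`1 ∪ *_L c = *_L c`).
[cite: Andre1996Motifs, §2.1 remark following Déf. 1 (p. 14)] -/
theorem isMotivatedClass_lefschetzInvolution (hX : Motives.IsSmoothProjective n X)
    {η : complexBetti X 2} (hη : IsPolarizationClass n X η) {b b' : ℕ} (hbb' : b + b' = n)
    (h₄ : 2 * b + 2 * b' = 2 * n) {c : complexBetti X (2 * b)} (hc : c ∈ algebraicClasses X b) :
    IsMotivatedClass n X b' (lefschetzInvolution hη.hasHardLefschetz h₄ c) := by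
  refine isMotivatedClass_of_eq_cupProduct_lefschetzInvolution hX hη hbb' (Nat.zero_add b') (by omega)
    (Nat.zero_add (2 * b')) h₄ (α := singularCohomology.one ℂ (Motives.ComplexPoints X)) ?_ hc
    (one_cupProduct _).symm
  rw [algebraicClasses_zero]
  trivial

/-- **`*_L A(X) ⊆ A_mot(X)`**, membership form: `*_{L_η} c ∈ A_mot^{b'}(X)_ℂ = motivatedClasses n X b'`
for `c ∈ Nᵇ H²ᵇ(X(ℂ); ℂ)`, `b + b' = n`, `η` a polarisation class of the smooth projective `n`-fold `X`.
[cite: Andre1996Motifs, §2.1 remark following Déf. 1 (p. 14)] -/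
theorem lefschetzInvolution_mem_motivatedClasses (hX : Motives.IsSmoothProjective n X)
    {η : complexBetti X 2} (hη : IsPolarizationClass n X η) {b b' : ℕ} (hbb' : b + b' = n)
    (h₄ : 2 * b + 2 * b' = 2 * n) {c : complexBetti X (2 * b)} (hc : c ∈ algebraicClasses X b) :
    lefschetzInvolution hη.hasHardLefschetz h₄ c ∈ motivatedClasses n X b' :=
  (isMotivatedClass_lefschetzInvolution hX hη hbb' h₄ hc).mem_motivatedClasses

/-- **`*_L A(X) ⊆ A_mot(X)`**, subspace form: the image of `Nᵇ H²ᵇ(X(ℂ); ℂ) = algebraicClasses X b`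
under `*_{L_η} : H²ᵇ → H^{2b'}` (`b + b' = n`) is contained in `A_mot^{b'}(X)_ℂ`.
[cite: Andre1996Motifs, §2.1 remark following Déf. 1 (p. 14)] -/
theorem map_algebraicClasses_lefschetzInvolution_le (hX : Motives.IsSmoothProjective n X)
    {η : complexBetti X 2} (hη : IsPolarizationClass n X η) {b b' : ℕ} (hbb' : b + b' = n)
    (h₄ : 2 * b + 2 * b' = 2 * n) :
    (algebraicClasses X b).map (lefschetzInvolution hη.hasHardLefschetz h₄) ≤ motivatedClasses n X b' := by
  rintro _ ⟨c, hc, rfl⟩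
  exact lefschetzInvolution_mem_motivatedClasses hX hη hbb' h₄ hc

/-! ### `A(X) ⊆ A_mot(X)` from a polarisation of `X` -/

/-- **Algebraic classes are generators of `A_mot(X)`, given a polarisation of `X` alone** (André
1996, §2.1, remark after Déf. 1, p. 14: "Il est clair que `A_mot(X)_E` contient `A(X)`", with
`Y = Spec ℂ`): for `X` smooth projective of dimension `n`, `η` a polarisation class of `X`, `p ≤ n` and
`c ∈ Nᵖ H²ᵖ(X(ℂ); ℂ)`, `c = c ∪ 1 = α ∪ *_L β` with `α = c` and `β ∈ H²ⁿ(X(ℂ); ℂ)` the class with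
`*_L β = 1` (`β = *_L 1 = ηⁿ`, algebraic as every top-degree class, `mem_algebraicClasses_of_degree_top`;
for `n = 0`, `Nⁿ H²ⁿ = H⁰`). Compare `isMotivatedClass_of_mem_algebraicClasses` (`Y = X`, polarisation of
`X ⊗ X`). [cite: Andre1996Motifs, §2.1 remark following Déf. 1 (p. 14)] -/
theorem isMotivatedClass_of_mem_algebraicClasses_of_isPolarizationClass
    (hX : Motives.IsSmoothProjective n X) {η : complexBetti X 2} (hη : IsPolarizationClass n X η)
    {p : ℕ} (hp : p ≤ n) {c : complexBetti X (2 * p)} (hc : c ∈ algebraicClasses X p) :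
    IsMotivatedClass n X p c := by
  have h₄ : 2 * n + 2 * 0 = 2 * n := by omega
  -- `β` with `*_L β = 1`
  obtain ⟨β, hβ1⟩ := (lefschetzInvolution_bijective hη.hasHardLefschetz h₄).2
    (singularCohomology.one ℂ (Motives.ComplexPoints X))
  have hβ : β ∈ algebraicClasses X n := by
    rcases Nat.eq_zero_or_pos n with rfl | hn
    · rw [algebraicClasses_zero]
      trivial
    · exact mem_algebraicClasses_of_degree_top hX hn β
  refine isMotivatedClass_of_eq_cupProduct_lefschetzInvolution hX hη (Nat.add_zero n) (Nat.add_zero p)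
    hp (Nat.add_zero (2 * p)) h₄ hc hβ ?_
  rw [hβ1]
  exact (cupProduct_one c).symm

/-- **`A(X) ⊆ A_mot(X)` from a polarisation of `X`** (André 1996, §2.1 remark, p. 14): for `X` smooth
projective of dimension `n` with a polarisation class `η`, `Nᵖ H²ᵖ(X(ℂ); ℂ) = algebraicClasses X p ≤
motivatedClasses n X p = A_motᵖ(X)_ℂ` for every `p` (`p > n`: `H²ᵖ(X(ℂ); ℂ) = 0`).
[cite: Andre1996Motifs, §2.1 remark following Déf. 1 (p. 14)] -/
theorem algebraicClasses_le_motivatedClasses_of_isPolarizationClass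
    (hX : Motives.IsSmoothProjective n X) {η : complexBetti X 2} (hη : IsPolarizationClass n X η)
    (p : ℕ) : algebraicClasses X p ≤ motivatedClasses n X p := by
  intro c hc
  by_cases hp : p ≤ n
  · exact (isMotivatedClass_of_mem_algebraicClasses_of_isPolarizationClass hX hη hp hc).mem_motivatedClasses
  · haveI := subsingleton_complexBetti hX (show 2 * n < 2 * p by omega)
    rw [Subsingleton.elim c 0]
    exact Submodule.zero_mem _

/-- **`A(X) ⊆ A_mot(X)` from the hard Lefschetz theorem for `X`** (André 1996, §2.1 remark; Voisin I
Thm. 6.25): granted the tree's named fact `nonempty_hardLefschetzNFold n X` (the smooth projective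
`n`-fold `X` carries a hard Lefschetz datum, in particular a polarisation class —
`HardLefschetzNFold.isPolarizationClass`), `algebraicClasses X p ≤ motivatedClasses n X p` for every `p`.
(The version of `MotivatedClassesAlgebraic` needs the datum of the `2n`-fold `X ⊗ X`.)
[cite: Andre1996Motifs, §2.1 remark following Déf. 1 (p. 14)] [cite: VoisinHodgeI2002, Thm. 6.25 and Rem. 6.27] -/
theorem algebraicClasses_le_motivatedClasses_of_nonempty_hardLefschetzNFold_self
    (hX : Motives.IsSmoothProjective n X) (hHL : nonempty_hardLefschetzNFold n X) (p : ℕ) :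
    algebraicClasses X p ≤ motivatedClasses n X p := by
  obtain ⟨Λ⟩ := hHL hX
  exact algebraicClasses_le_motivatedClasses_of_isPolarizationClass hX Λ.isPolarizationClass p

/-- **`*_L A(X) ⊆ A_mot(X)` from the hard Lefschetz theorem for `X`**: for a hard Lefschetz datum `Λ`
of the smooth projective `n`-fold `X` (hyperplane class `[H]`), `*_{L_{[H]}} c ∈ A_mot^{b'}(X)_ℂ` for
every `c ∈ Nᵇ H²ᵇ(X(ℂ); ℂ)`, `b + b' = n`. [cite: Andre1996Motifs, §2.1 remark following Déf. 1 (p. 14)]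
[cite: VoisinHodgeI2002, Thm. 6.25 and Rem. 6.27] -/
theorem HardLefschetzNFold.lefschetzInvolution_mem_motivatedClasses (hX : Motives.IsSmoothProjective n X)
    (Λ : HardLefschetzNFold n X) {b b' : ℕ} (hbb' : b + b' = n) (h₄ : 2 * b + 2 * b' = 2 * n)
    {c : complexBetti X (2 * b)} (hc : c ∈ algebraicClasses X b) :
    lefschetzInvolution Λ.hasHardLefschetz h₄ c ∈ motivatedClasses n X b' :=
  HodgeTheory.lefschetzInvolution_mem_motivatedClasses hX Λ.isPolarizationClass hbb' h₄ hc

/-! ### The deformation step of §6.3 with the hard Lefschetz datum of the fibre itself -/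

section Deformation

/-- **The use of Thm. 0.5 in the proof of Thm. 0.6.2** (André 1996, §6.3, p. 33: the global section
of Lemme 6.3.3 (iii) has an ALGEBRAIC fibre at `s₀`, and "les cycles motivés sont préservés par
déformation plate dans le pinceau"), in the global-class form of the named fact `Andre1996_deformation`
(Thm. 0.5, granted as `h`), as in
`Andre1996_deformation.map_fiber_mem_motivatedClasses_of_mem_algebraicClasses` of
`MotivatedClassesAlgebraic` but granted only the hard Lefschetz datum of the FIBRE `𝒳_{s₀}`
(`nonempty_hardLefschetzNFold n 𝒳_{s₀}`, Voisin I Thm. 6.25) instead of that of `𝒳_{s₀} ⊗ 𝒳_{s₀}`: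
a global class `A ∈ H²ᵖ(𝒳(ℂ); ℂ)` of a smooth projective family over a reduced connected base whose
restriction to `𝒳_{s₀}` is algebraic restricts to a motivated class on every fibre
(`algebraicClasses_le_motivatedClasses_of_nonempty_hardLefschetzNFold_self` at `s₀`, then Thm. 0.5).
[cite: Andre1996Motifs, §6.3 (p. 33) and Thm. 0.5 (p. 8)] [cite: VoisinHodgeI2002, Thm. 6.25 and Rem. 6.27] -/
theorem Andre1996_deformation.map_fiber_mem_motivatedClasses_of_mem_algebraicClasses_self
    (h : Andre1996_deformation) ⦃n : ℕ⦄ ⦃𝒳 S : Motives.SchemeOver ℂ⦄ (f : 𝒳 ⟶ S)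
    (hf : Motives.IsSmoothProjectiveFamily f n)
    (hproj : ∃ (N : ℕ) (ι : 𝒳 ⟶ Motives.projectiveSpace N ℂ ⊗ S),
      IsClosedImmersion ι.left ∧ ι ≫ snd (Motives.projectiveSpace N ℂ) S = f)
    (hred : IsReduced S.left) (hconn : ConnectedSpace S.left) (hft : LocallyOfFiniteType S.hom)
    (hqc : QuasiCompact S.hom) (p : ℕ) (A : complexBetti 𝒳 (2 * p)) (s₀ : Motives.ComplexPoints S)
    (hHL : nonempty_hardLefschetzNFold n (Motives.fiberOver f s₀))
    (hA : complexBetti.map (Motives.fiberι f s₀) (2 * p) A ∈ algebraicClasses (Motives.fiberOver f s₀) p)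
    (s : Motives.ComplexPoints S) :
    complexBetti.map (Motives.fiberι f s) (2 * p) A ∈ motivatedClasses n (Motives.fiberOver f s) p :=
  h f hf hproj hred hconn hft hqc p A s₀
    (algebraicClasses_le_motivatedClasses_of_nonempty_hardLefschetzNFold_self (hf.isSmoothProjective s₀)
      hHL p hA) s

end Deformation

end HodgeTheory

end Literature.AlgebraicGeometry.HodgeTheory

end
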